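import Summits.KontsevichZagierPeriods.Zeta5Search.RVLargeParamZCoverBands
import HarnessLib

/-!
# RVLargeParamZCoverBonus — the cover at the floor exponent is PROVED; only the bonus units are open (fam-rv gen 9, file 8; #9.5)

HONEST FRAMING: systematic search; no irrationality claim unless certified.  Second step of the PROOF of the combinatorial cover
`LargeParamZCover` (gen 9 file 6, `RVLargeParamVCover.lean`; bands in file 7, `RVLargeParamZCoverBands.lean`).  Write
`t = −N_p(b) + lpBonus(b,p)` for the target exponent of the constant-term floor (V⁺).

* PROVED — COUNTING AT THE FLOOR EXPONENT: for every `c` in the polytope inside the window `c₀ + 2 < p²` with no residue class holding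
  two poles, the counting test fires at every `t ≤ −N_p(c)` (`countingCase_of_le_neg_pairFloors`).  This is the typer's THEOREM V
  engine `ClusterValuation.neg_pairFloors_le_classNu` (`ConstantTermFloorWindow.lean`: a tame single pole has `ν_x ≥ 0`, a non-tame
  single pole has a neutral class point below it and then order `≤ N_p(c)` by `SinglePoleExpBound`, typer g8).  Since
  `N_p(b + e_j) ≤ N_p(b)` (`pairFloors_shift_le`), BOTH `b` and `b + e_j` pass the counting test at every `t ≤ −N_p(b)`
  (`countingPair_of_le_neg_pairFloors`); in particular the cover holds whenever `lpBonus(b,p) = 0` (`zCoverPair_of_bonus_eq_zero`) —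
  e.g. for every `b` with all seven lower parameters `< p`; among the regime instances with `b₀ ≤ 24` and `p ≤ m₁(b)` these are
  88,584 of 94,097 (`rv9_tmax.py`, exact count).
* CONSEQUENCE — what is open of (CV⁺) is exactly the BONUS: the one or two units `lpBonus(b,p) ∈ {1, 2}` above the floor exponent
  (so `nbig(b,p) ≥ 1`: some lower parameter is `≥ p`, and `[LP] = 1` or `2p ≤ d(b)`).  The two OBSERVED band nodes of file 7 are
  restated WITH THE BONUS HYPOTHESIS `1 ≤ lpBonus(b,p)` — `LargeParamZCoverMidPos`, `LargeParamHighBandPos` (minted by this cell from the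
  exact census of files 6/7, NOT published results; `@[conjecture]`, hypotheses only) — and PROVED to imply the file-7 nodes
  (`largeParamZCoverMid_of_pos`, `largeParamHighBand_of_pos`), hence `LargeParamZCover`, `LargeParamVFloor`, `LargeParamClassLaw` and
  `FlatGaugeLawF1` (`largeParamZCover_of_posBands`, …).

`p`-adic valuations of rational numbers and block combinatorics only; nothing about irrationality.
-/

noncomputable section

open Finset

namespace Summit.KontsevichZagierPeriods.Zeta5Search.RVFlatGauge

open Summit.KontsevichZagierPeriods.Zeta5Search.CasoratianValuation (shift InPolytope pairFloors)
open Summit.KontsevichZagierPeriods.Zeta5Search.ClusterValuation (classPoleCount neg_pairFloors_le_classNu pairFloors_shift_le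
  classPoleCount_le_one_of_short_blocks classPoleCount_shift_le)
open Cap

variable {p : ℕ}

/-- **COUNTING AT THE FLOOR EXPONENT (PROVED):** in the polytope and the window, if no class holds two poles then the counting test
fires at every `t ≤ −N_p(c)` (THEOREM V's engine `neg_pairFloors_le_classNu`). -/
theorem countingCase_of_le_neg_pairFloors (c : ℕ → ℤ) (hc : InPolytope c) (hpr : p.Prime) (hp5 : 5 ≤ p)
    (hwin : (c 0 + 2 : ℤ) < (p : ℤ) ^ 2) (h1 : ∀ x, classPoleCount c p x ≤ 1) {t : ℤ} (ht : t ≤ -pairFloors c p) :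
    countingCase c p t = true := by
  haveI : Fact p.Prime := ⟨hpr⟩
  unfold countingCase
  refine decide_eq_true fun x hx hpole => ht.trans ?_
  exact neg_pairFloors_le_classNu c hc hp5 hwin (mem_range.1 hx) hpole fun h => by have := h1 x; omega

/-- **BOTH CONSTANT TERMS AT THE FLOOR EXPONENT (PROVED):** with at most one long block, `b` and `b + e_j` pass the counting test at every
`t ≤ −N_p(b)` (`N_p(b + e_j) ≤ N_p(b)`). -/
theorem countingPair_of_le_neg_pairFloors (b : ℕ → ℤ) {j i : ℕ} (hb : InPolytope b) (hj1 : 1 ≤ j) (hb' : InPolytope (shift b j))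
    (hpr : p.Prime) (hp5 : 5 ≤ p) (hwin : (b 0 + 2 : ℤ) < (p : ℤ) ^ 2)
    (hshort : ∀ k ∈ (range 7).erase i, b 0 - 2 * b (k + 1) < p) {t : ℤ} (ht : t ≤ -pairFloors b p) :
    countingCase b p t = true ∧ countingCase (shift b j) p t = true := by
  have h1 : ∀ x, classPoleCount b p x ≤ 1 := fun x => classPoleCount_le_one_of_short_blocks b hb hpr.pos hshort x
  have h1' : ∀ x, classPoleCount (shift b j) p x ≤ 1 := fun x => (classPoleCount_shift_le b hb.1 hj1 p x).trans (h1 x)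
  have h0 : shift b j 0 = b 0 := BigPrime.shift_zero b hj1
  have hN := pairFloors_shift_le b hj1 p hpr.pos
  exact ⟨countingCase_of_le_neg_pairFloors b hb hpr hp5 hwin h1 ht,
    countingCase_of_le_neg_pairFloors (shift b j) hb' hpr hp5 (by rw [h0]; exact hwin) h1' (by linarith)⟩

/-- **THE COVER WITHOUT BONUS (PROVED):** if `lpBonus(b,p) = 0` both `b` and `b + e_j` pass the counting test at `t = −N_p(b)`, hence
`provedCaseZ`. -/
theorem zCoverPair_of_bonus_eq_zero (b : ℕ → ℤ) {j i : ℕ} (hb : InPolytope b) (hj1 : 1 ≤ j) (hb' : InPolytope (shift b j))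
    (hpr : p.Prime) (hp5 : 5 ≤ p) (hwin : (b 0 + 2 : ℤ) < (p : ℤ) ^ 2)
    (hshort : ∀ k ∈ (range 7).erase i, b 0 - 2 * b (k + 1) < p) (h0 : lpBonus b p = 0) :
    provedCaseZ b p (-pairFloors b p + lpBonus b p) = true ∧
      provedCaseZ (shift b j) p (-pairFloors b p + lpBonus b p) = true := by
  obtain ⟨h1, h2⟩ := countingPair_of_le_neg_pairFloors b hb hj1 hb' hpr hp5 hwin hshort
    (t := -pairFloors b p + lpBonus b p) (by rw [h0]; simp)
  simp only [provedCaseZ, Bool.or_eq_true]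
  exact ⟨Or.inl (Or.inl (Or.inl h1)), Or.inl (Or.inl (Or.inl h2))⟩

/-- **MID BAND WITH BONUS, OBSERVED** (minted by this cell; NOT a published result): the combinatorial cover on the pairs with
`lpBonus(b,p) ≥ 1` and `−5 ≤ −N_p(b) + lpBonus(b,p) ≤ −4`. -/
@[conjecture] def LargeParamZCoverMidPos : Prop :=
  ∀ (b : ℕ → ℤ) (j p i : ℕ), InPolytope b → 1 ≤ j → j ≤ 7 → InPolytope (shift b j) → p.Prime → 5 ≤ p →
    (b 0 + 2 : ℤ) < (p : ℤ) ^ 2 → (∀ k ∈ (range 7).erase i, b 0 - 2 * b (k + 1) < p) → 1 ≤ lpBonus b p →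
    -5 ≤ -pairFloors b p + lpBonus b p → -pairFloors b p + lpBonus b p ≤ -4 →
    provedCaseZ b p (-pairFloors b p + lpBonus b p) = true ∧
      provedCaseZ (shift b j) p (-pairFloors b p + lpBonus b p) = true

/-- **HIGH BAND WITH BONUS IS COUNTING, OBSERVED** (minted by this cell; NOT a published result): for `lpBonus(b,p) ≥ 1` and
`−N_p(b) + lpBonus(b,p) ≥ −3` both constant terms pass the counting test. -/
@[conjecture] def LargeParamHighBandPos : Prop :=
  ∀ (b : ℕ → ℤ) (j p i : ℕ), InPolytope b → 1 ≤ j → j ≤ 7 → InPolytope (shift b j) → p.Prime → 5 ≤ p →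
    (b 0 + 2 : ℤ) < (p : ℤ) ^ 2 → (∀ k ∈ (range 7).erase i, b 0 - 2 * b (k + 1) < p) → 1 ≤ lpBonus b p →
    -3 ≤ -pairFloors b p + lpBonus b p →
    countingCase b p (-pairFloors b p + lpBonus b p) = true ∧
      countingCase (shift b j) p (-pairFloors b p + lpBonus b p) = true

/-- **REDUCTION (PROVED):** the mid band needs only its bonus case. -/
theorem largeParamZCoverMid_of_pos (hM : LargeParamZCoverMidPos) : LargeParamZCoverMid := by
  intro b j p i hb hj1 hj7 hb' hpr hp5 hwin hshort h5 h4
  rcases (lpBonus_nonneg b p).eq_or_lt with h0 | hpos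
  · exact zCoverPair_of_bonus_eq_zero b hb hj1 hb' hpr hp5 hwin hshort h0.symm
  · exact hM b j p i hb hj1 hj7 hb' hpr hp5 hwin hshort (by omega) h5 h4

/-- **REDUCTION (PROVED):** the high band needs only its bonus case. -/
theorem largeParamHighBand_of_pos (hH : LargeParamHighBandPos) : LargeParamHighBandCounting := by
  intro b j p i hb hj1 hj7 hb' hpr hp5 hwin hshort h3
  rcases (lpBonus_nonneg b p).eq_or_lt with h0 | hpos
  · exact countingPair_of_le_neg_pairFloors b hb hj1 hb' hpr hp5 hwin hshort (by rw [← h0]; simp)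
  · exact hH b j p i hb hj1 hj7 hb' hpr hp5 hwin hshort (by omega) h3

/-- **REDUCTION (PROVED): the two bonus bands give the cover.** -/
theorem largeParamZCover_of_posBands (hM : LargeParamZCoverMidPos) (hH : LargeParamHighBandPos) : LargeParamZCover :=
  largeParamZCover_of_bands (largeParamZCoverMid_of_pos hM) (largeParamHighBand_of_pos hH)

/-- bonus bands ⇒ (V⁺). -/
theorem largeParamVFloor_of_posBands (hM : LargeParamZCoverMidPos) (hH : LargeParamHighBandPos) : LargeParamVFloor :=
  largeParamVFloor_of_zCover (largeParamZCover_of_posBands hM hH)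

/-- bonus bands ⇒ (CV⁺). -/
theorem largeParamClassLaw_of_posBands (hM : LargeParamZCoverMidPos) (hH : LargeParamHighBandPos) : LargeParamClassLaw :=
  largeParamClassLaw_of_zCover (largeParamZCover_of_posBands hM hH)

/-- bonus bands ⇒ FLAT on (F1). -/
theorem flatGaugeLawF1_of_posBands (hM : LargeParamZCoverMidPos) (hH : LargeParamHighBandPos) : FlatGaugeLawF1 :=
  flatGaugeLawF1_of_zCover (largeParamZCover_of_posBands hM hH)

/- Sanity (kernel `decide`): on `b = (15; 7,7,7,7,5,5,0)`, `p = 7` (`N = 6`, `lpBonus = 1`) the counting test FIRES at the floor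
exponent `−6` (this file's theorem) and FAILS at the target `−5` (file 7's example): the open content is exactly the bonus unit. -/
example : countingCase (fun k => [(15 : ℤ), 7, 7, 7, 7, 5, 5, 0].getD k 0) 7 (-6) = true := by decide

end Summit.KontsevichZagierPeriods.Zeta5Search.RVFlatGauge

end
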